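import Summits.AtomisticToContinuum.FouriersLaw.Theorems.PhononMeanFreePathIncoherentChannelTimeResolvedBudgetHelper1
import Summits.AtomisticToContinuum.FouriersLaw.Theorems.PhononMeanFreePathIncoherentChannelCommonPastBoundHelper2

/-!
# `IncoherentChannel`, line `two-horizons-forecast-loss` — the TIME-RESOLVED forecast budget

Helper file for the lead's stub `stub_forecastLoss` (the ENGINE) of crux `PhononMeanFreePath.IncoherentChannel`
(item stmt-AtomisticToContinuum-11811, route `PhononMeanFreePath`, sub-problem `FouriersLaw`), in the vocabulary
of `PhononMeanFreePathDefs`. For the `(N+1)`-site pinned anharmonic chain `pinnedChain ω₂ lam β γ` with both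
Langevin baths at `T` (`μ₀ = gibbsMeasure (N+1) T`, `K_t = transitionKernel (N+1) T T t⁺`, the CONSTRUCTED
objects) write `u_t = fcast … N t = K_t p_N` (mean forecast of the bath momentum), `S_N(t) = fnorm … N t =
‖u_t‖²_{L²(μ₀)}`, `r_N(t) = pairCorr … N t = ∫ p_0 u_t dμ₀` (the route's coherent channel) and
`a_N(t) = ∫ p_N u_t dμ₀` (the echo of the bath momentum). This file proves the **time-resolved budget**

  `S_N(t) + (2γ/T) ∫_{0<s≤t} (r_N(s)² + a_N(s)²) ds ≤ S_N(0) = T`   for every `N` and every `t ≥ 0`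

(`forecastBudget_timeResolved_lintegral_le`, lower integral; `forecastBudget_timeResolved_integral_le`, Bochner;
registered closed form `forecastBudget_timeResolved`). It refines the tree's `t = ∞` budget
`∫_{t>0} (r_N² + a_N²) ≤ T²/(2γ)` (`forecastBudget`, file `…ForecastBudget`) by KEEPING the forecast norm `S_N(t)`:
the exact dissipation handle `dS/dt = -2γ Σ_i w_i ‖∂_{p_i} u_t‖²` on a finite horizon
(`dissipation_lintegral_le_timeResolved'`, file `…TimeResolvedBudgetHelper1`) with BOTH bath terms
(`sum_bathWeight_mul_eq`), Gaussian integration by parts `r² ≤ T²‖∂_{p_0}u‖²`, `a² ≤ T²‖∂_{p_N}u‖²`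
(`ofReal_sq_integral_snd_mul_forecast_le`) for `F ∈ C_c`, then truncation `χ_k p_N → p_N`: dominated convergence
inside both correlations, Fatou in `z` for the forecast-norm term, Fatou in `s` for the channel term, and the
superadditivity of `liminf`. No definitions; nothing here closes an item.
-/

noncomputable section

namespace Summit.AtomisticToContinuum.FouriersLaw.Theorems.PhononMeanFreePath

open MeasureTheory ProbabilityTheory Set Filter Topology
open scoped NNReal ENNReal ContDiff
open Literature.MathematicalPhysics.KineticTheory.HeatConduction
open Literature.MathematicalPhysics.KineticTheory Literature.Probability.Process OscillatorChain
open Summit.AtomisticToContinuum.FouriersLaw.Theorems.IncoherentBounded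
open Summit.AtomisticToContinuum.FouriersLaw.Theorems.SubdiffusiveBondHeat

/-! ### The time-resolved budget for a compactly supported observable -/

section Smooth

variable {ω₂ lam β γ : ℝ} (hω : 0 < ω₂) (hl : 0 ≤ lam) (hβ : 0 < β) (hγ : 0 < γ) {T : ℝ} (hT : 0 < T) (N : ℕ)
include hω hl hβ hγ hT

/-- **The time-resolved two-sided coherent bound for `F ∈ C_c(Ω)`** on the `(N+1)`-site chain: for `t > 0`,

  `‖K_t F‖²_{L²(μ_T)} + (2γ/T) ∫_{0<s≤t} [(∫ p_0 K_s F dμ_T)² + (∫ p_N K_s F dμ_T)²] ds ≤ ∫ F² dμ_T`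

(lower Lebesgue integral in `s`): both bath terms of the time-resolved dissipation inequality
`dissipation_lintegral_le_timeResolved'` and the pointwise coherent bounds
`(∫ p_j K_s F dμ_T)² ≤ T² ∫ (∂_{p_j} K_s F)² dμ_T` at `j = 0` and `j = N`.
(adapted from `forecastBudget_lintegral_smooth_le`, the `t = ∞` version without the `‖K_t F‖²` term) [folklore] -/
theorem forecastBudget_timeResolved_smooth_le {F : PhaseSpace (N + 1) → ℝ} (hFc : Continuous F)
    (hFs : HasCompactSupport F) {t : ℝ} (ht : 0 < t) :
    ENNReal.ofReal (∫ x, (∫ y, F y ∂((pinnedChain ω₂ lam β γ).transitionKernel (N + 1) T T t.toNNReal x)) ^ 2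
        ∂((pinnedChain ω₂ lam β γ).gibbsMeasure (N + 1) T)) +
      ENNReal.ofReal (2 * γ / T) * ∫⁻ s in Ioc (0 : ℝ) t, (ENNReal.ofReal ((∫ x, x.2 0 *
        (∫ y, F y ∂((pinnedChain ω₂ lam β γ).transitionKernel (N + 1) T T s.toNNReal x))
          ∂((pinnedChain ω₂ lam β γ).gibbsMeasure (N + 1) T)) ^ 2) +
      ENNReal.ofReal ((∫ x, x.2 (Fin.last N) *
        (∫ y, F y ∂((pinnedChain ω₂ lam β γ).transitionKernel (N + 1) T T s.toNNReal x))
          ∂((pinnedChain ω₂ lam β γ).gibbsMeasure (N + 1) T)) ^ 2)) ≤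
      ENNReal.ofReal (∫ x, F x ^ 2 ∂((pinnedChain ω₂ lam β γ).gibbsMeasure (N + 1) T)) := by
  -- adapted from `forecastBudget_lintegral_smooth_le` (file `…IncoherentChannelForecastBudget`)
  have hNp : 0 < N + 1 := Nat.succ_pos N
  set P := pinnedChain ω₂ lam β γ with hP
  set μ := P.gibbsMeasure (N + 1) T with hμ
  set U : ℝ → PhaseSpace (N + 1) → ℝ := fun s z => ∫ y, F y ∂(P.transitionKernel (N + 1) T T s.toNNReal z) with hU
  -- the time-resolved dissipation inequality with BOTH bath terms
  have hD := dissipation_lintegral_le_timeResolved' hω hl hβ hγ hNp hT hFc hFs ht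
  -- the pointwise comparison for `s > 0`
  have hstep : ∀ s : ℝ, 0 < s →
      ENNReal.ofReal (2 * γ / T) * (ENNReal.ofReal ((∫ x, x.2 0 * U s x ∂μ) ^ 2) +
        ENNReal.ofReal ((∫ x, x.2 (Fin.last N) * U s x ∂μ) ^ 2)) ≤
        ∫⁻ x, ENNReal.ofReal (2 * (γ * ∑ i : Fin (N + 1),
          ((if i.val = 0 then T else 0) + (if i.val = N + 1 - 1 then T else 0)) * partialP i (U s) x ^ 2)) ∂μ := by
    intro s hs
    have hu2 : ContDiff ℝ 2 (U s) := contDiff_forecast hω hl hγ hNp hβ.le hT hT.le hFc hFs hs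
    have hm : ∀ j : Fin (N + 1), Measurable fun x => ENNReal.ofReal (partialP j (U s) x ^ 2) := fun j =>
      ((continuous_partialP hu2 two_ne_zero j).measurable.pow_const 2).ennreal_ofReal
    have h0 := ofReal_sq_integral_snd_mul_forecast_le hω hl hβ hγ hT hNp (0 : Fin (N + 1)) hFc hFs hs
    have h1 := ofReal_sq_integral_snd_mul_forecast_le hω hl hβ hγ hT hNp (Fin.last N) hFc hFs hs
    -- both gradients under ONE integral
    have hsum : (∫⁻ x, ENNReal.ofReal (partialP 0 (U s) x ^ 2) ∂μ) +
        ∫⁻ x, ENNReal.ofReal (partialP (Fin.last N) (U s) x ^ 2) ∂μ =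
        ∫⁻ x, (ENNReal.ofReal (partialP 0 (U s) x ^ 2) + ENNReal.ofReal (partialP (Fin.last N) (U s) x ^ 2)) ∂μ :=
      (lintegral_add_left (hm 0) _).symm
    have hpt : ∀ x, ENNReal.ofReal (2 * γ * T) * (ENNReal.ofReal (partialP 0 (U s) x ^ 2) +
        ENNReal.ofReal (partialP (Fin.last N) (U s) x ^ 2)) ≤
        ENNReal.ofReal (2 * (γ * ∑ i : Fin (N + 1),
          ((if i.val = 0 then T else 0) + (if i.val = N + 1 - 1 then T else 0)) * partialP i (U s) x ^ 2)) := by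
      intro x
      rw [← ENNReal.ofReal_add (sq_nonneg _) (sq_nonneg _), ← ENNReal.ofReal_mul (by positivity)]
      refine ENNReal.ofReal_le_ofReal (le_of_eq ?_)
      rw [sum_bathWeight_mul_eq N T (fun i => partialP i (U s) x ^ 2)]
      ring
    have hcmp : ENNReal.ofReal (2 * γ * T) * ((∫⁻ x, ENNReal.ofReal (partialP 0 (U s) x ^ 2) ∂μ) +
        ∫⁻ x, ENNReal.ofReal (partialP (Fin.last N) (U s) x ^ 2) ∂μ) ≤
        ∫⁻ x, ENNReal.ofReal (2 * (γ * ∑ i : Fin (N + 1),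
          ((if i.val = 0 then T else 0) + (if i.val = N + 1 - 1 then T else 0)) * partialP i (U s) x ^ 2)) ∂μ := by
      rw [hsum, ← lintegral_const_mul' _ _ ENNReal.ofReal_ne_top]
      exact lintegral_mono hpt
    have hTfac : ENNReal.ofReal (2 * γ / T) * ENNReal.ofReal (T ^ 2) = ENNReal.ofReal (2 * γ * T) := by
      rw [← ENNReal.ofReal_mul (by positivity)]
      congr 1
      rw [div_mul_eq_mul_div, div_eq_iff hT.ne']
      ring
    calc ENNReal.ofReal (2 * γ / T) * (ENNReal.ofReal ((∫ x, x.2 0 * U s x ∂μ) ^ 2) +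
          ENNReal.ofReal ((∫ x, x.2 (Fin.last N) * U s x ∂μ) ^ 2))
        ≤ ENNReal.ofReal (2 * γ / T) * (ENNReal.ofReal (T ^ 2) * (∫⁻ x, ENNReal.ofReal (partialP 0 (U s) x ^ 2) ∂μ) +
          ENNReal.ofReal (T ^ 2) * ∫⁻ x, ENNReal.ofReal (partialP (Fin.last N) (U s) x ^ 2) ∂μ) :=
          mul_le_mul_right (add_le_add h0 h1) _
      _ = ENNReal.ofReal (2 * γ * T) * ((∫⁻ x, ENNReal.ofReal (partialP 0 (U s) x ^ 2) ∂μ) +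
            ∫⁻ x, ENNReal.ofReal (partialP (Fin.last N) (U s) x ^ 2) ∂μ) := by
          rw [← mul_add, ← mul_assoc, hTfac]
      _ ≤ _ := hcmp
  -- integrate over `0 < s ≤ t` and add the forecast norm at the horizon
  calc ENNReal.ofReal (∫ x, U t x ^ 2 ∂μ) + ENNReal.ofReal (2 * γ / T) * ∫⁻ s in Ioc (0 : ℝ) t,
        (ENNReal.ofReal ((∫ x, x.2 0 * U s x ∂μ) ^ 2) + ENNReal.ofReal ((∫ x, x.2 (Fin.last N) * U s x ∂μ) ^ 2))
      = ENNReal.ofReal (∫ x, U t x ^ 2 ∂μ) + ∫⁻ s in Ioc (0 : ℝ) t, ENNReal.ofReal (2 * γ / T) *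
          (ENNReal.ofReal ((∫ x, x.2 0 * U s x ∂μ) ^ 2) + ENNReal.ofReal ((∫ x, x.2 (Fin.last N) * U s x ∂μ) ^ 2)) := by
        rw [lintegral_const_mul' _ _ ENNReal.ofReal_ne_top]
    _ ≤ ENNReal.ofReal (∫ x, U t x ^ 2 ∂μ) + ∫⁻ s in Ioc (0 : ℝ) t, ∫⁻ x, ENNReal.ofReal (2 * (γ * ∑ i : Fin (N + 1),
          ((if i.val = 0 then T else 0) + (if i.val = N + 1 - 1 then T else 0)) * partialP i (U s) x ^ 2)) ∂μ :=
        add_le_add le_rfl (setLIntegral_mono' measurableSet_Ioc fun s hs => hstep s hs.1)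
    _ ≤ ENNReal.ofReal (∫ x, F x ^ 2 ∂μ) := hD

end Smooth

/-! ### The time-resolved budget for the bath momentum: truncation, dominated convergence, Fatou twice -/

section Item

variable {ω₂ lam β γ : ℝ} (hω : 0 < ω₂) (hl : 0 ≤ lam) (hβ : 0 < β) (hγ : 0 < γ) {T : ℝ} (hT : 0 < T)
include hω hl hβ hγ hT

/-- **The time-resolved forecast budget, lower-integral form.** For every `N` and every `t > 0`,

  `S_N(t) + (2γ/T) ∫_{0<s≤t} (r_N(s)² + a_N(s)²) ds ≤ T`

(`S_N = fnorm`, `r_N = pairCorr`, `a_N(s) = ∫ p_N (K_s p_N) dμ₀`; the time integral is a lower Lebesgue integral):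
truncate `p_N` to `F_k = χ_k p_N ∈ C_c` (`∫ F_k² dμ₀ ≤ ∫ p_N² dμ₀ = T`), apply `forecastBudget_timeResolved_smooth_le`,
pass to the limit inside the forecasts and both correlations by dominated convergence, and conclude by Fatou in
`z` (forecast-norm term), Fatou in `s` (channel term) and `liminf A_k + liminf B_k ≤ liminf (A_k + B_k)`.
(adapted from `forecastBudget_lintegral_le`) [folklore] -/
theorem forecastBudget_timeResolved_lintegral_le (N : ℕ) {t : ℝ} (ht : 0 < t) :
    ENNReal.ofReal (fnorm ω₂ lam β γ T N t) + ENNReal.ofReal (2 * γ / T) *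
      ∫⁻ s in Ioc (0 : ℝ) t, ENNReal.ofReal ((pairCorr ω₂ lam β γ T N s) ^ 2 +
        (∫ z, z.2 (Fin.last N) * fcast ω₂ lam β γ T N s z ∂((pinnedChain ω₂ lam β γ).gibbsMeasure (N + 1) T)) ^ 2) ≤
      ENNReal.ofReal T := by
  -- adapted from `forecastBudget_lintegral_le` (file `…IncoherentChannelForecastBudget`)
  set P := pinnedChain ω₂ lam β γ with hP
  set μ := P.gibbsMeasure (N + 1) T with hμ
  haveI : IsProbabilityMeasure μ := pinnedChain_isProbabilityMeasure_gibbsMeasure hω hl hβ.le γ (N + 1) hT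
  haveI : ∀ t, IsMarkovKernel (P.transitionKernel (N + 1) T T t) := fun t =>
    pinnedChain_isMarkovKernel_transitionKernel hω hl hβ.le hγ.le (N + 1) T T t
  have hNp : 0 < N + 1 := Nat.succ_pos N
  -- the truncations `F_k = χ_k · p_N`
  set pL : PhaseSpace (N + 1) → ℝ := fun y => y.2 (Fin.last N) with hpL
  have hpLc : Continuous pL := by fun_prop
  set χ : ℕ → ContDiffBump (0 : PhaseSpace (N + 1)) := fun k =>
    ⟨(k : ℝ) + 1, (k : ℝ) + 2, by positivity, by linarith⟩ with hχ
  set Fk : ℕ → PhaseSpace (N + 1) → ℝ := fun k y => (χ k) y * pL y with hFk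
  have hFkc : ∀ k, Continuous (Fk k) := fun k => (χ k).continuous.mul hpLc
  have hFks : ∀ k, HasCompactSupport (Fk k) := fun k => (χ k).hasCompactSupport.mul_right
  have hFk_le : ∀ k y, |Fk k y| ≤ |pL y| := fun k y => by
    rw [hFk]; dsimp only; rw [abs_mul, abs_of_nonneg (χ k).nonneg]
    exact mul_le_of_le_one_left (abs_nonneg _) (χ k).le_one
  have hFk_lim : ∀ y, Tendsto (fun k => Fk k y) atTop (𝓝 (pL y)) := by
    intro y
    refine tendsto_const_nhds.congr' ?_
    obtain ⟨k₀, hk₀⟩ := exists_nat_ge ‖y‖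
    filter_upwards [eventually_ge_atTop k₀] with k hk
    rw [hFk]; dsimp only
    rw [(χ k).one_of_mem_closedBall, one_mul]
    rw [Metric.mem_closedBall, dist_zero_right]
    calc ‖y‖ ≤ k₀ := hk₀
      _ ≤ k := by exact_mod_cast hk
      _ ≤ (k : ℝ) + 1 := by linarith
  -- `L²(μ₀)`-norms of the truncations: `∫ F_k² dμ₀ ≤ ∫ p_N² dμ₀ = T`
  have hϑ0 : (0 : ℝ) < 1 / (4 * T) := by positivity
  have hϑ1 : 1 / (4 * T) < 1 / T := by
    rw [div_lt_div_iff₀ (by positivity) hT]; nlinarith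
  have h2ϑ : 2 * (1 / (4 * T)) < 1 / T := by
    rw [show 2 * (1 / (4 * T)) = 1 / (2 * T) by field_simp; ring, div_lt_div_iff₀ (by positivity) hT]; nlinarith
  have hexpμ := pinnedChain_integrable_exp_mul_hamiltonian_gibbsMeasure hω hl hβ.le γ (N + 1) hT hϑ1
  have hpL2 : Integrable (fun y => pL y ^ 2) μ :=
    integrable_of_abs_le_exp hexpμ (by fun_prop) (fun y => by
      rw [abs_of_nonneg (sq_nonneg _)]
      exact sq_momentum_le_exp (γ := γ) hω hl hβ.le hϑ0 y (Fin.last N))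
  have hFk2 : ∀ k, ∫ y, Fk k y ^ 2 ∂μ ≤ T := by
    intro k
    rw [← integral_momentum_sq_gibbsMeasure (γ := γ) hω hl hβ hT (N + 1) (Fin.last N)]
    refine integral_mono_of_nonneg (ae_of_all _ fun y => sq_nonneg _) hpL2 (ae_of_all _ fun y => ?_)
    show Fk k y ^ 2 ≤ y.2 (Fin.last N) ^ 2
    exact (sq_le_sq' (abs_le.1 (hFk_le k y)).1 (abs_le.1 (hFk_le k y)).2).trans (le_of_eq (sq_abs _))
  -- exponential weight bounds (domain of the `L²(μ₀)`-contraction lemma)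
  have hpLexp : ∀ y, |pL y| ≤ (1 / 2 + 1 / (1 / (4 * T))) * Real.exp (1 / (4 * T) * P.hamiltonian (N + 1) y) :=
    fun y => abs_momentum_le_exp hω hl hβ.le hϑ0 y (Fin.last N)
  have hFkexp : ∀ k y, |Fk k y| ≤ (1 / 2 + 1 / (1 / (4 * T))) * Real.exp (1 / (4 * T) * P.hamiltonian (N + 1) y) :=
    fun k y => (hFk_le k y).trans (hpLexp y)
  -- the approximating correlations with weight `p_j` (`j = 0`: coherent channel; `j = N`: echo) and their limits
  set ck : Fin (N + 1) → ℕ → ℝ → ℝ := fun j k s => ∫ z, z.2 j *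
    (∫ y, Fk k y ∂(P.transitionKernel (N + 1) T T s.toNNReal z)) ∂μ with hck
  set c : Fin (N + 1) → ℝ → ℝ := fun j s => ∫ z, z.2 j *
    (∫ y, pL y ∂(P.transitionKernel (N + 1) T T s.toNNReal z)) ∂μ with hc
  have hck_meas : ∀ j k, Measurable (ck j k) := fun j k =>
    measurable_corr hω hl hβ hγ hT (f := fun z : PhaseSpace (N + 1) => z.2 j) (by fun_prop) (hFkc k)
  -- dominated convergence inside the kernels
  have hin : ∀ (s : ℝ) (z : PhaseSpace (N + 1)),
      Tendsto (fun k => ∫ y, Fk k y ∂(P.transitionKernel (N + 1) T T s.toNNReal z)) atTop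
        (𝓝 (∫ y, pL y ∂(P.transitionKernel (N + 1) T T s.toNNReal z))) := by
    intro s z
    have hexpK := pinnedChain_integrable_exp_mul_hamiltonian_transitionKernel hω hl hT hβ.le hγ.le hNp hϑ0 hϑ1
      s.toNNReal z
    have hbd : Integrable (fun y => |pL y|) (P.transitionKernel (N + 1) T T s.toNNReal z) :=
      integrable_of_abs_le_exp hexpK (by fun_prop) (fun y => by
        rw [abs_abs]; exact abs_momentum_le_exp hω hl hβ.le hϑ0 y (Fin.last N))
    refine tendsto_integral_of_dominated_convergence (fun y => |pL y|)
      (fun k => (hFkc k).aestronglyMeasurable) hbd (fun k => ae_of_all _ fun y => ?_)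
      (ae_of_all _ fun y => hFk_lim y)
    rw [Real.norm_eq_abs]; exact hFk_le k y
  -- dominated convergence under `μ₀`, for either weight
  have hout : ∀ (j : Fin (N + 1)) (s : ℝ), Tendsto (fun k => ck j k s) atTop (𝓝 (c j s)) := by
    intro j s
    have hdom : Integrable (fun z : PhaseSpace (N + 1) => |z.2 j| *
        ∫ y, |pL y| ∂(P.transitionKernel (N + 1) T T s.toNNReal z)) μ :=
      integrable_mul_act hω hl hβ hγ hT (f := fun z : PhaseSpace (N + 1) => |z.2 j|) (g := fun y => |pL y|)
        (by fun_prop) (by fun_prop)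
        (fun y => by rw [abs_abs]; exact abs_momentum_le_exp hω hl hβ.le hϑ0 y j)
        (fun y => by rw [abs_abs]; exact abs_momentum_le_exp hω hl hβ.le hϑ0 y (Fin.last N)) s.toNNReal
    refine tendsto_integral_of_dominated_convergence
      (fun z : PhaseSpace (N + 1) => |z.2 j| * ∫ y, |pL y| ∂(P.transitionKernel (N + 1) T T s.toNNReal z))
      (fun k => ?_) hdom (fun k => ae_of_all _ fun z => ?_) (ae_of_all _ fun z => (hin s z).const_mul (z.2 j))
    · exact (Continuous.aestronglyMeasurable (by fun_prop)).mul
        ((hFkc k).stronglyMeasurable.integral_kernel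
          (κ := P.transitionKernel (N + 1) T T s.toNNReal)).aestronglyMeasurable
    · rw [Real.norm_eq_abs, abs_mul]
      refine mul_le_mul_of_nonneg_left ?_ (abs_nonneg _)
      have hexpK := pinnedChain_integrable_exp_mul_hamiltonian_transitionKernel hω hl hT hβ.le hγ.le hNp hϑ0 hϑ1
        s.toNNReal z
      have hbd : Integrable (fun y => |pL y|) (P.transitionKernel (N + 1) T T s.toNNReal z) :=
        integrable_of_abs_le_exp hexpK (by fun_prop) (fun y => by
          rw [abs_abs]; exact abs_momentum_le_exp hω hl hβ.le hϑ0 y (Fin.last N))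
      calc |∫ y, Fk k y ∂(P.transitionKernel (N + 1) T T s.toNNReal z)|
          ≤ ∫ y, |Fk k y| ∂(P.transitionKernel (N + 1) T T s.toNNReal z) := abs_integral_le_integral_abs
        _ ≤ ∫ y, |pL y| ∂(P.transitionKernel (N + 1) T T s.toNNReal z) :=
          integral_mono_of_nonneg (ae_of_all _ fun y => abs_nonneg _) hbd (ae_of_all _ fun y => hFk_le k y)
  -- (a) the forecast-norm term at the horizon: Fatou in `z`
  set wk : ℕ → PhaseSpace (N + 1) → ℝ := fun k z => ∫ y, Fk k y ∂(P.transitionKernel (N + 1) T T t.toNNReal z)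
    with hwk
  set w : PhaseSpace (N + 1) → ℝ := fun z => ∫ y, pL y ∂(P.transitionKernel (N + 1) T T t.toNNReal z) with hw
  have hwk_meas : ∀ k, Measurable (wk k) := fun k =>
    ((hFkc k).stronglyMeasurable.integral_kernel (κ := P.transitionKernel (N + 1) T T t.toNNReal)).measurable
  have hwk2 : ∀ k, Integrable (fun z => wk k z ^ 2) μ := fun k =>
    (pinnedChain_integral_sq_act_le hω hl hβ hγ hNp hT hϑ0 h2ϑ (hFkc k) (hFkexp k) t.toNNReal).2.1
  have hw2 : Integrable (fun z => w z ^ 2) μ :=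
    (pinnedChain_integral_sq_act_le hω hl hβ hγ hNp hT hϑ0 h2ϑ hpLc hpLexp t.toNNReal).2.1
  have hAterm : ENNReal.ofReal (∫ z, w z ^ 2 ∂μ) ≤ liminf (fun k => ENNReal.ofReal (∫ z, wk k z ^ 2 ∂μ)) atTop := by
    have hl1 : ∀ z, liminf (fun k => ENNReal.ofReal (wk k z ^ 2)) atTop = ENNReal.ofReal (w z ^ 2) := fun z =>
      (ENNReal.tendsto_ofReal ((hin t z).pow 2)).liminf_eq
    calc ENNReal.ofReal (∫ z, w z ^ 2 ∂μ) = ∫⁻ z, ENNReal.ofReal (w z ^ 2) ∂μ :=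
          ofReal_integral_eq_lintegral_ofReal hw2 (ae_of_all _ fun z => sq_nonneg _)
      _ = ∫⁻ z, liminf (fun k => ENNReal.ofReal (wk k z ^ 2)) atTop ∂μ := lintegral_congr fun z => (hl1 z).symm
      _ ≤ liminf (fun k => ∫⁻ z, ENNReal.ofReal (wk k z ^ 2) ∂μ) atTop :=
          lintegral_liminf_le fun k => ((hwk_meas k).pow_const 2).ennreal_ofReal
      _ = liminf (fun k => ENNReal.ofReal (∫ z, wk k z ^ 2 ∂μ)) atTop :=
          Filter.liminf_congr (Eventually.of_forall fun k =>
            (ofReal_integral_eq_lintegral_ofReal (hwk2 k) (ae_of_all _ fun z => sq_nonneg _)).symm)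
  -- (b) the channel term: Fatou in `s`
  set Bk : ℕ → ℝ → ℝ≥0∞ := fun k s => ENNReal.ofReal (2 * γ / T) *
    (ENNReal.ofReal (ck 0 k s ^ 2) + ENNReal.ofReal (ck (Fin.last N) k s ^ 2)) with hBk
  have hBk_meas : ∀ k, Measurable (Bk k) := fun k =>
    ((((hck_meas 0 k).pow_const 2).ennreal_ofReal).add
      (((hck_meas (Fin.last N) k).pow_const 2).ennreal_ofReal)).const_mul _
  have hBlim : ∀ s, liminf (fun k => Bk k s) atTop =
      ENNReal.ofReal (2 * γ / T) * ENNReal.ofReal (c 0 s ^ 2 + c (Fin.last N) s ^ 2) := by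
    intro s
    refine Tendsto.liminf_eq ?_
    rw [ENNReal.ofReal_add (sq_nonneg (c 0 s)) (sq_nonneg (c (Fin.last N) s))]
    exact ENNReal.Tendsto.const_mul ((ENNReal.tendsto_ofReal ((hout 0 s).pow 2)).add
      (ENNReal.tendsto_ofReal ((hout (Fin.last N) s).pow 2))) (Or.inr ENNReal.ofReal_ne_top)
  have hBterm : ENNReal.ofReal (2 * γ / T) * ∫⁻ s in Ioc (0 : ℝ) t, ENNReal.ofReal (c 0 s ^ 2 + c (Fin.last N) s ^ 2) ≤
      liminf (fun k => ENNReal.ofReal (2 * γ / T) * ∫⁻ s in Ioc (0 : ℝ) t,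
        (ENNReal.ofReal (ck 0 k s ^ 2) + ENNReal.ofReal (ck (Fin.last N) k s ^ 2))) atTop := by
    calc ENNReal.ofReal (2 * γ / T) * ∫⁻ s in Ioc (0 : ℝ) t, ENNReal.ofReal (c 0 s ^ 2 + c (Fin.last N) s ^ 2)
        = ∫⁻ s in Ioc (0 : ℝ) t, ENNReal.ofReal (2 * γ / T) * ENNReal.ofReal (c 0 s ^ 2 + c (Fin.last N) s ^ 2) :=
          (lintegral_const_mul' _ _ ENNReal.ofReal_ne_top).symm
      _ = ∫⁻ s in Ioc (0 : ℝ) t, liminf (fun k => Bk k s) atTop := lintegral_congr fun s => (hBlim s).symm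
      _ ≤ liminf (fun k => ∫⁻ s in Ioc (0 : ℝ) t, Bk k s) atTop := lintegral_liminf_le hBk_meas
      _ = liminf (fun k => ENNReal.ofReal (2 * γ / T) * ∫⁻ s in Ioc (0 : ℝ) t,
            (ENNReal.ofReal (ck 0 k s ^ 2) + ENNReal.ofReal (ck (Fin.last N) k s ^ 2))) atTop :=
          Filter.liminf_congr (Eventually.of_forall fun k => lintegral_const_mul' _ _ ENNReal.ofReal_ne_top)
  -- (c) the budget of each truncation, and superadditivity of `liminf`
  have hk_bound : ∀ k, ENNReal.ofReal (∫ z, wk k z ^ 2 ∂μ) + ENNReal.ofReal (2 * γ / T) * ∫⁻ s in Ioc (0 : ℝ) t,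
      (ENNReal.ofReal (ck 0 k s ^ 2) + ENNReal.ofReal (ck (Fin.last N) k s ^ 2)) ≤ ENNReal.ofReal T := fun k =>
    (forecastBudget_timeResolved_smooth_le hω hl hβ hγ hT N (hFkc k) (hFks k) ht).trans
      (ENNReal.ofReal_le_ofReal (hFk2 k))
  calc ENNReal.ofReal (∫ z, w z ^ 2 ∂μ) + ENNReal.ofReal (2 * γ / T) *
        ∫⁻ s in Ioc (0 : ℝ) t, ENNReal.ofReal (c 0 s ^ 2 + c (Fin.last N) s ^ 2)
      ≤ liminf (fun k => ENNReal.ofReal (∫ z, wk k z ^ 2 ∂μ)) atTop +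
          liminf (fun k => ENNReal.ofReal (2 * γ / T) * ∫⁻ s in Ioc (0 : ℝ) t,
            (ENNReal.ofReal (ck 0 k s ^ 2) + ENNReal.ofReal (ck (Fin.last N) k s ^ 2))) atTop :=
        add_le_add hAterm hBterm
    _ ≤ liminf (fun k => ENNReal.ofReal (∫ z, wk k z ^ 2 ∂μ) + ENNReal.ofReal (2 * γ / T) * ∫⁻ s in Ioc (0 : ℝ) t,
            (ENNReal.ofReal (ck 0 k s ^ 2) + ENNReal.ofReal (ck (Fin.last N) k s ^ 2))) atTop :=
        add_liminf_le_liminf_add _ _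
    _ ≤ ENNReal.ofReal T := liminf_le_of_frequently_le' (Frequently.of_forall hk_bound)

/-- **The time-resolved forecast budget, Bochner form.** For every `N` and every `t ≥ 0`,

  `S_N(t) + (2γ/T) ∫_{0<s≤t} (r_N(s)² + a_N(s)²) ds ≤ T = S_N(0)`

— the forecast norm of the bath momentum still held at the horizon `t` plus what the two baths have already
spent through the coherent channel `r_N` and the echo `a_N` never exceeds the initial budget `T`, uniformly in `N`
(at `t = 0` the window is empty and `S_N(0) ≤ T`; for `t > 0` the integrand is integrable on the finite window by
the fixed-`N` exponential decay of both correlations, and the bound is `forecastBudget_timeResolved_lintegral_le`).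
[folklore] -/
theorem forecastBudget_timeResolved_integral_le (N : ℕ) {t : ℝ} (ht : 0 ≤ t) :
    fnorm ω₂ lam β γ T N t + (2 * γ / T) * ∫ s in Ioc (0 : ℝ) t, ((pairCorr ω₂ lam β γ T N s) ^ 2 +
      (∫ z, z.2 (Fin.last N) * fcast ω₂ lam β γ T N s z ∂((pinnedChain ω₂ lam β γ).gibbsMeasure (N + 1) T)) ^ 2) ≤
      T := by
  obtain rfl | hpos := ht.eq_or_lt
  · rw [Set.Ioc_self, Measure.restrict_empty, integral_zero_measure, mul_zero, add_zero]
    exact (commonPastBound_fnorm_le hω hl hβ.le hγ.le hT N 0).2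
  set R : ℝ → ℝ := fun s => (pairCorr ω₂ lam β γ T N s) ^ 2 +
    (∫ z, z.2 (Fin.last N) * fcast ω₂ lam β γ T N s z ∂((pinnedChain ω₂ lam β γ).gibbsMeasure (N + 1) T)) ^ 2
    with hR
  -- integrability on the finite window (fixed-`N` exponential decay of both correlations)
  have hr : IntegrableOn (fun s => (pairCorr ω₂ lam β γ T N s) ^ 2) (Ioc (0 : ℝ) t) :=
    (rN_sq_integrableOn hω hl hβ hγ hT N).mono_set Ioc_subset_Ioi_self
  have ha : IntegrableOn (fun s => (∫ z, z.2 (Fin.last N) * fcast ω₂ lam β γ T N s z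
      ∂((pinnedChain ω₂ lam β γ).gibbsMeasure (N + 1) T)) ^ 2) (Ioc (0 : ℝ) t) :=
    (aN_sq_integrableOn hω hl hβ hγ hT N).mono_set Ioc_subset_Ioi_self
  have hi : IntegrableOn R (Ioc (0 : ℝ) t) := hr.add ha
  have hR0 : ∀ s, 0 ≤ R s := fun s => add_nonneg (sq_nonneg _) (sq_nonneg _)
  have hI0 : 0 ≤ ∫ s in Ioc (0 : ℝ) t, R s := integral_nonneg hR0
  have key := forecastBudget_timeResolved_lintegral_le hω hl hβ hγ hT N hpos
  have e1 : ∫⁻ s in Ioc (0 : ℝ) t, ENNReal.ofReal (R s) = ENNReal.ofReal (∫ s in Ioc (0 : ℝ) t, R s) :=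
    (ofReal_integral_eq_lintegral_ofReal hi (ae_of_all _ hR0)).symm
  rw [e1, ← ENNReal.ofReal_mul (by positivity), ← ENNReal.ofReal_add (fnorm_nonneg ω₂ lam β γ T N t)
    (mul_nonneg (by positivity) hI0), ENNReal.ofReal_le_ofReal_iff hT.le] at key
  exact key

end Item

/-- **THE TIME-RESOLVED FORECAST BUDGET** (registered helper of line `two-horizons-forecast-loss`, closed form of
`forecastBudget_timeResolved_integral_le`): for the pinned anharmonic chain (`ω₂, β, γ > 0`, `lam ≥ 0`) with both
baths at `T > 0`, EVERY `N` and every horizon `t ≥ 0`,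

  `S_N(t) + (2γ/T) ∫_{0<s≤t} (r_N(s)² + a_N(s)²) ds ≤ T`,

`S_N = fnorm` the forecast norm of the bath momentum `p_N`, `r_N = pairCorr` the route's coherent channel,
`a_N(s) = ∫ p_N (K_s p_N) dμ₀` its echo: the Bakry–Émery dissipation identity `dS/dt = -2γ Σ_i w_i ‖∂_{p_i}K_t p_N‖²`
integrated on `[0, t]`, with Gaussian integration by parts on the two bath momenta. The engine `stub_forecastLoss`
asks for the `N`-uniform RATE at which `S_N` is spent; this is the exact `N`-uniform bookkeeping of what it is spent
on. [folklore] -/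
theorem forecastBudget_timeResolved : ∀ ω₂ lam β γ : ℝ, 0 < ω₂ → 0 ≤ lam → 0 < β → 0 < γ → ∀ T : ℝ, 0 < T → ∀ (N : ℕ) (t : ℝ), 0 ≤ t → fnorm ω₂ lam β γ T N t + (2 * γ / T) * ∫ s in Ioc (0 : ℝ) t, ((pairCorr ω₂ lam β γ T N s) ^ 2 + (∫ z, z.2 (Fin.last N) * fcast ω₂ lam β γ T N s z ∂((pinnedChain ω₂ lam β γ).gibbsMeasure (N + 1) T)) ^ 2) ≤ T :=
  fun _ _ _ _ hω hl hβ hγ _ hT N _ ht => forecastBudget_timeResolved_integral_le hω hl hβ hγ hT N ht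

end Summit.AtomisticToContinuum.FouriersLaw.Theorems.PhononMeanFreePath

end
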